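import Summits.ValiantsHypothesis.ValiantsHypothesis.Theorems.NewtonTauWeak.Negative.AlignedPeelingCorner

/-!
# `NewtonTauWeak` (stmt-5904), line `aligned-peeling` refuted — part 2b: domination, exposure engine,
# representation uniqueness, triangle bound (negative lane)

The series `Theorems/NewtonTauWeak/Negative/AlignedPeeling*.lean` refutes the load-bearing stub `stub_alignedPeeling`
(`∃ C c, AlignedPeeling C c`) of the registered line `aligned-peeling` of crux `NewtonTauWeak`
(stmt-ValiantsHypothesis-5904); see `AlignedPeelingSumset.lean` for the overview.  The LINE dies; the crux itself
stays OPEN; nothing here bears on `VP ≠ VNP`.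

This file (generic value arguments over sumsets of `Fin ℓ`-indexed families):
* `not_isUniqueMin_of_dominated` — a deviation that is a convex combination of two others plus a non-negative cone
  vector is never the unique minimiser of a cone-positive form;
* `target_lt_of_values` — the exposure engine: additive non-negative "values" single out `(ℓ-1)•c + q`;
* `rep_summit_unique`, `rep_guard_unique` — unique representations of the summit and of a guard point;
* `fv_triangle_ge` — in the triangle `x + y ≤ D` a real form is at least its minimum over the corners.
[folklore]
-/

set_option linter.dupNamespace false

namespace Summit.ValiantsHypothesis.ValiantsHypothesis.Theorems.NewtonTauWeak.Negative.AlignedPeelingCex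

open scoped BigOperators
open MvPolynomial Finset
open Summit.ValiantsHypothesis.ValiantsHypothesis.Theorems.NewtonTauWeak.Negative (vert)

noncomputable section

/-! ## B.2 Domination: dominated deviations are never unique minimisers -/

/-- **Domination.**  If `t = λ t₁ + (1-λ) t₂ + α (a - c) + β (b - c)` with `t₁, t₂, a, b ∈ U`, `λ ∈ [0,1]`,
`α, β ≥ 0`, and either `(α, β) ≠ 0` or `t₁ ≠ t ≠ t₂`, then `t` is not the unique minimiser over `U` of any real
form that is larger on `U` than at `c`. [folklore] -/
theorem not_isUniqueMin_of_dominated (U : Finset (Fin 2 →₀ ℕ)) (c a b t t₁ t₂ : Fin 2 →₀ ℕ) (ξ₀ ξ₁ : ℝ)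
    (hpos : ∀ t' ∈ U, fv ξ₀ ξ₁ c < fv ξ₀ ξ₁ t') (ha : a ∈ U) (hb : b ∈ U) (h₁ : t₁ ∈ U) (h₂ : t₂ ∈ U)
    (lam α β : ℝ) (hl0 : 0 ≤ lam) (hl1 : lam ≤ 1) (hα : 0 ≤ α) (hβ : 0 ≤ β)
    (h0 : (t 0 : ℝ) = lam * t₁ 0 + (1 - lam) * t₂ 0 + α * ((a 0 : ℝ) - c 0) + β * ((b 0 : ℝ) - c 0))
    (h1 : (t 1 : ℝ) = lam * t₁ 1 + (1 - lam) * t₂ 1 + α * ((a 1 : ℝ) - c 1) + β * ((b 1 : ℝ) - c 1))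
    (hnd : (0 < α ∨ 0 < β) ∨ (t₁ ≠ t ∧ t₂ ≠ t)) :
    ¬ IsUniqueMin ξ₀ ξ₁ U t := by
  rintro ⟨_, hmin⟩
  have hft : fv ξ₀ ξ₁ t = lam * fv ξ₀ ξ₁ t₁ + (1 - lam) * fv ξ₀ ξ₁ t₂ +
      α * (fv ξ₀ ξ₁ a - fv ξ₀ ξ₁ c) + β * (fv ξ₀ ξ₁ b - fv ξ₀ ξ₁ c) := by
    have e0 : ξ₀ * (t 0 : ℝ) = ξ₀ * (lam * t₁ 0 + (1 - lam) * t₂ 0 + α * ((a 0 : ℝ) - c 0) +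
        β * ((b 0 : ℝ) - c 0)) := by rw [h0]
    have e1 : ξ₁ * (t 1 : ℝ) = ξ₁ * (lam * t₁ 1 + (1 - lam) * t₂ 1 + α * ((a 1 : ℝ) - c 1) +
        β * ((b 1 : ℝ) - c 1)) := by rw [h1]
    simp only [fv]
    linarith
  have hle₁ : fv ξ₀ ξ₁ t ≤ fv ξ₀ ξ₁ t₁ := by
    rcases eq_or_ne t₁ t with h | h
    · rw [h]
    · exact (hmin t₁ h₁ h).le
  have hle₂ : fv ξ₀ ξ₁ t ≤ fv ξ₀ ξ₁ t₂ := by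
    rcases eq_or_ne t₂ t with h | h
    · rw [h]
    · exact (hmin t₂ h₂ h).le
  have hpa : 0 < fv ξ₀ ξ₁ a - fv ξ₀ ξ₁ c := sub_pos.mpr (hpos a ha)
  have hpb : 0 < fv ξ₀ ξ₁ b - fv ξ₀ ξ₁ c := sub_pos.mpr (hpos b hb)
  have hA : 0 ≤ α * (fv ξ₀ ξ₁ a - fv ξ₀ ξ₁ c) := mul_nonneg hα hpa.le
  have hB : 0 ≤ β * (fv ξ₀ ξ₁ b - fv ξ₀ ξ₁ c) := mul_nonneg hβ hpb.le
  have hL₁ : lam * fv ξ₀ ξ₁ t ≤ lam * fv ξ₀ ξ₁ t₁ := mul_le_mul_of_nonneg_left hle₁ hl0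
  have hL₂ : (1 - lam) * fv ξ₀ ξ₁ t ≤ (1 - lam) * fv ξ₀ ξ₁ t₂ :=
    mul_le_mul_of_nonneg_left hle₂ (sub_nonneg.mpr hl1)
  rcases hnd with (hα' | hβ') | ⟨hne₁, hne₂⟩
  · have hA' : 0 < α * (fv ξ₀ ξ₁ a - fv ξ₀ ξ₁ c) := mul_pos hα' hpa
    linarith
  · have hB' : 0 < β * (fv ξ₀ ξ₁ b - fv ξ₀ ξ₁ c) := mul_pos hβ' hpb
    linarith
  · have hlt₁ : fv ξ₀ ξ₁ t < fv ξ₀ ξ₁ t₁ := hmin t₁ h₁ hne₁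
    have hlt₂ : fv ξ₀ ξ₁ t < fv ξ₀ ξ₁ t₂ := hmin t₂ h₂ hne₂
    rcases eq_or_lt_of_le hl0 with h | h
    · rw [← h] at hft
      linarith
    · have : lam * fv ξ₀ ξ₁ t < lam * fv ξ₀ ξ₁ t₁ := mul_lt_mul_of_pos_left hlt₁ h
      linarith

/-! ## B.3 The exposure engine and representation uniqueness (value arguments) -/

/-- Value bookkeeping: `fv` of `(ℓ-1)•c + t`. -/
theorem fv_devPoint {ℓ : ℕ} (hℓ : 1 ≤ ℓ) (ξ₀ ξ₁ : ℝ) (c t : Fin 2 →₀ ℕ) :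
    fv ξ₀ ξ₁ ((ℓ - 1) • c + t) = ((ℓ : ℝ) - 1) * fv ξ₀ ξ₁ c + fv ξ₀ ξ₁ t := by
  rw [fv_add, fv_nsmul, Nat.cast_sub hℓ, Nat.cast_one]

/-- Value bookkeeping: the form of a sumset point minus `ℓ` times the corner value is the sum of the deviations'
values. -/
theorem fv_sum_sub {ℓ : ℕ} (ξ₀ ξ₁ : ℝ) (c : Fin 2 →₀ ℕ) (f : Fin ℓ → (Fin 2 →₀ ℕ)) :
    fv ξ₀ ξ₁ (∑ i, f i) - ℓ * fv ξ₀ ξ₁ c = ∑ i, (fv ξ₀ ξ₁ (f i) - fv ξ₀ ξ₁ c) := by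
  rw [Finset.sum_sub_distrib, fv_sum, Finset.sum_const, Finset.card_univ, Fintype.card_fin, nsmul_eq_mul]

/-- A choice function with at most one non-`c` entry is an update of the constant one. -/
theorem eq_update_of_atMostOne {ℓ : ℕ} (c : Fin 2 →₀ ℕ) (f : Fin ℓ → (Fin 2 →₀ ℕ)) (i₀ : Fin ℓ)
    (h : ∀ i, f i ≠ c → i = i₀) : f = Function.update (fun _ => c) i₀ (f i₀) := by
  funext i
  rcases eq_or_ne i i₀ with rfl | hne
  · simp
  · rw [Function.update_of_ne hne]
    by_contra hfi
    exact hne (h i hfi)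

/-- **Exposure engine.**  Values `v(t) = fv t - fv c` over the factors: positive off `c`, at least `Vq` off
`{c, g}` with equality only at `q`, and the guard `g` available in at most one factor.  Then every sumset point
other than the summit `ℓ•c`, the guard point `(ℓ-1)•c + g` and the target `(ℓ-1)•c + q` has form value strictly
above the target's. [folklore] -/
theorem target_lt_of_values {ℓ : ℕ} (hℓ : 1 ≤ ℓ) (T : Fin ℓ → Finset (Fin 2 →₀ ℕ)) (c g q : Fin 2 →₀ ℕ)
    (ξ₀ ξ₁ Vq : ℝ) (hq : fv ξ₀ ξ₁ q - fv ξ₀ ξ₁ c = Vq)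
    (hF2 : ∀ i, ∀ t ∈ T i, t ≠ c → fv ξ₀ ξ₁ c < fv ξ₀ ξ₁ t)
    (hF3 : ∀ i, ∀ t ∈ T i, t ≠ c → t ≠ g → t ≠ q → Vq < fv ξ₀ ξ₁ t - fv ξ₀ ξ₁ c)
    (hF4 : ∀ i i', g ∈ T i → g ∈ T i' → i = i')
    (e : Fin 2 →₀ ℕ) (he : e ∈ sumset T) (h1 : e ≠ ℓ • c) (h2 : e ≠ (ℓ - 1) • c + g)
    (h3 : e ≠ (ℓ - 1) • c + q) :
    fv ξ₀ ξ₁ ((ℓ - 1) • c + q) < fv ξ₀ ξ₁ e := by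
  classical
  obtain ⟨f, hfpi, hfe⟩ := (mem_sumset_iff T e).mp he
  have hf : ∀ i, f i ∈ T i := Fintype.mem_piFinset.mp hfpi
  -- reduce to a statement about the deviation values
  have hF3w : ∀ i, ∀ t ∈ T i, t ≠ c → t ≠ g → Vq ≤ fv ξ₀ ξ₁ t - fv ξ₀ ξ₁ c := by
    intro i t ht hc hg
    rcases eq_or_ne t q with rfl | hne
    · rw [hq]
    · exact (hF3 i t ht hc hg hne).le
  have hnonneg : ∀ i ∈ (Finset.univ : Finset (Fin ℓ)), 0 ≤ fv ξ₀ ξ₁ (f i) - fv ξ₀ ξ₁ c := by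
    intro i _
    rcases eq_or_ne (f i) c with h | h
    · rw [h, sub_self]
    · exact (sub_pos.mpr (hF2 i _ (hf i) h)).le
  suffices hmain : Vq < ∑ i, (fv ξ₀ ξ₁ (f i) - fv ξ₀ ξ₁ c) by
    rw [← fv_sum_sub, hfe] at hmain
    rw [fv_devPoint hℓ]
    linarith
  by_cases hex : ∃ i₁ i₂, i₁ ≠ i₂ ∧ f i₁ ≠ c ∧ f i₂ ≠ c
  · obtain ⟨i₁, i₂, hne, hc₁, hc₂⟩ := hex
    -- one of the two deviating entries is not the guard
    obtain ⟨p, r, hpr, hpc, hpg, hrc⟩ : ∃ p r, p ≠ r ∧ f p ≠ c ∧ f p ≠ g ∧ f r ≠ c := by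
      by_cases hg₂ : f i₂ = g
      · refine ⟨i₁, i₂, hne, hc₁, fun hg₁ => hne ?_, hc₂⟩
        exact hF4 i₁ i₂ (hg₁ ▸ hf i₁) (hg₂ ▸ hf i₂)
      · exact ⟨i₂, i₁, hne.symm, hc₂, hg₂, hc₁⟩
    have hsub : ({p, r} : Finset (Fin ℓ)) ⊆ Finset.univ := Finset.subset_univ _
    have hle := Finset.sum_le_sum_of_subset_of_nonneg hsub (fun i hi _ => hnonneg i hi)
    rw [Finset.sum_pair hpr] at hle
    have hp : Vq ≤ fv ξ₀ ξ₁ (f p) - fv ξ₀ ξ₁ c := hF3w p _ (hf p) hpc hpg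
    have hr : 0 < fv ξ₀ ξ₁ (f r) - fv ξ₀ ξ₁ c := sub_pos.mpr (hF2 r _ (hf r) hrc)
    linarith
  · push Not at hex
    obtain ⟨i₀, hi₀⟩ : ∃ i, f i ≠ c := by
      by_contra hall
      push Not at hall
      apply h1
      rw [← hfe, show f = fun _ => c from funext hall]
      simp
    have hone : ∀ i, f i ≠ c → i = i₀ := by
      intro i hi
      by_contra hne
      exact hi₀ (hex i i₀ hne hi)
    have hfupd := eq_update_of_atMostOne c f i₀ hone
    have herepr : e = (ℓ - 1) • c + f i₀ := by rw [← hfe, hfupd, update_sum_eq]; simp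
    have hg₀ : f i₀ ≠ g := fun h => h2 (by rw [herepr, h])
    have hq₀ : f i₀ ≠ q := fun h => h3 (by rw [herepr, h])
    have hlt : Vq < fv ξ₀ ξ₁ (f i₀) - fv ξ₀ ξ₁ c := hF3 i₀ _ (hf i₀) hi₀ hg₀ hq₀
    have hle : fv ξ₀ ξ₁ (f i₀) - fv ξ₀ ξ₁ c ≤ ∑ i, (fv ξ₀ ξ₁ (f i) - fv ξ₀ ξ₁ c) :=
      Finset.single_le_sum hnonneg (Finset.mem_univ i₀)
    linarith

/-- **Unique representation of the summit.**  If the form is larger off `c` in every factor, the summit `ℓ•c`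
is represented only by the constant choice. [folklore] -/
theorem rep_summit_unique {ℓ : ℕ} (T : Fin ℓ → Finset (Fin 2 →₀ ℕ)) (c : Fin 2 →₀ ℕ) (ξ₀ ξ₁ : ℝ)
    (hF2 : ∀ i, ∀ t ∈ T i, t ≠ c → fv ξ₀ ξ₁ c < fv ξ₀ ξ₁ t)
    (f : Fin ℓ → (Fin 2 →₀ ℕ)) (hf : ∀ i, f i ∈ T i) (hsum : ∑ i, f i = ℓ • c) : f = fun _ => c := by
  have hnonneg : ∀ i ∈ (Finset.univ : Finset (Fin ℓ)), 0 ≤ fv ξ₀ ξ₁ (f i) - fv ξ₀ ξ₁ c := by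
    intro i _
    rcases eq_or_ne (f i) c with h | h
    · rw [h, sub_self]
    · exact (sub_pos.mpr (hF2 i _ (hf i) h)).le
  have hzero : ∑ i, (fv ξ₀ ξ₁ (f i) - fv ξ₀ ξ₁ c) = 0 := by
    rw [← fv_sum_sub, hsum, fv_nsmul, sub_self]
  funext i
  by_contra hne
  have hpos : 0 < fv ξ₀ ξ₁ (f i) - fv ξ₀ ξ₁ c := sub_pos.mpr (hF2 i _ (hf i) hne)
  have := (Finset.sum_eq_zero_iff_of_nonneg hnonneg).mp hzero i (Finset.mem_univ i)
  linarith

/-- **Unique representation of the guard point.**  If every non-`c` factor point has value `≥ Vg > 0` with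
equality only at `g`, and `g` belongs to factor `i₀` only, then `(ℓ-1)•c + g` is represented only by the choice
"`g` at `i₀`, `c` elsewhere". [folklore] -/
theorem rep_guard_unique {ℓ : ℕ} (hℓ : 1 ≤ ℓ) (T : Fin ℓ → Finset (Fin 2 →₀ ℕ)) (c g : Fin 2 →₀ ℕ)
    (ξ₀ ξ₁ Vg : ℝ) (hVg : 0 < Vg) (hg : fv ξ₀ ξ₁ g - fv ξ₀ ξ₁ c = Vg)
    (hF3 : ∀ i, ∀ t ∈ T i, t ≠ c → t ≠ g → Vg < fv ξ₀ ξ₁ t - fv ξ₀ ξ₁ c)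
    (i₀ : Fin ℓ) (hF4 : ∀ i, g ∈ T i → i = i₀)
    (f : Fin ℓ → (Fin 2 →₀ ℕ)) (hf : ∀ i, f i ∈ T i) (hsum : ∑ i, f i = (ℓ - 1) • c + g) :
    f = Function.update (fun _ => c) i₀ g := by
  classical
  have hF3w : ∀ i, ∀ t ∈ T i, t ≠ c → Vg ≤ fv ξ₀ ξ₁ t - fv ξ₀ ξ₁ c := by
    intro i t ht hc
    rcases eq_or_ne t g with rfl | hne
    · rw [hg]
    · exact (hF3 i t ht hc hne).le
  have hnonneg : ∀ i ∈ (Finset.univ : Finset (Fin ℓ)), 0 ≤ fv ξ₀ ξ₁ (f i) - fv ξ₀ ξ₁ c := by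
    intro i _
    rcases eq_or_ne (f i) c with h | h
    · rw [h, sub_self]
    · linarith [hF3w i _ (hf i) h]
  have htot : ∑ i, (fv ξ₀ ξ₁ (f i) - fv ξ₀ ξ₁ c) = Vg := by
    rw [← fv_sum_sub, hsum, fv_devPoint hℓ, ← hg]; ring
  -- at most one deviating entry
  have hone : ∀ i₁ i₂, f i₁ ≠ c → f i₂ ≠ c → i₁ = i₂ := by
    intro i₁ i₂ h₁ h₂
    by_contra hne
    have hsub : ({i₁, i₂} : Finset (Fin ℓ)) ⊆ Finset.univ := Finset.subset_univ _
    have hle := Finset.sum_le_sum_of_subset_of_nonneg hsub (fun i hi _ => hnonneg i hi)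
    rw [Finset.sum_pair hne, htot] at hle
    have := hF3w i₁ _ (hf i₁) h₁
    have := hF3w i₂ _ (hf i₂) h₂
    linarith
  -- at least one deviating entry
  obtain ⟨i₁, hi₁⟩ : ∃ i, f i ≠ c := by
    by_contra hall
    push Not at hall
    have : ∑ i, (fv ξ₀ ξ₁ (f i) - fv ξ₀ ξ₁ c) = 0 := by
      refine Finset.sum_eq_zero fun i _ => ?_
      rw [hall i, sub_self]
    linarith
  have hfupd := eq_update_of_atMostOne c f i₁ (fun i hi => hone i i₁ hi hi₁)
  -- its value is exactly `Vg`, so it is `g`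
  have hval : fv ξ₀ ξ₁ (f i₁) - fv ξ₀ ξ₁ c = Vg := by
    rw [← htot]
    symm
    refine Finset.sum_eq_single i₁ (fun i _ hne => ?_) (by simp)
    have hfi : f i = c := by
      by_contra h
      exact hne (hone i i₁ h hi₁)
    rw [hfi, sub_self]
  have hfg : f i₁ = g := by
    by_contra hne
    have := hF3 i₁ _ (hf i₁) hi₁ hne
    linarith
  have hi : i₁ = i₀ := hF4 i₁ (hfg ▸ hf i₁)
  rw [hfupd, hfg, hi]

/-! ## B.4 The triangle: a sumset minimiser is a summit -/

/-- In the lattice triangle `x + y ≤ D` a real form is bounded below by its minimum over the three corners,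
written multiplicatively: `D · fv t ≥ min(0, t-weighted corner values)`. -/
theorem fv_triangle_ge (ξ₀ ξ₁ m : ℝ) (D : ℕ) (t : Fin 2 →₀ ℕ) (ht : t 0 + t 1 ≤ D)
    (h0 : m ≤ 0) (h1 : m ≤ ξ₀ * D) (h2 : m ≤ ξ₁ * D) : m ≤ fv ξ₀ ξ₁ t := by
  rcases Nat.eq_zero_or_pos D with hD | hD
  · subst hD
    have ht0 : t 0 = 0 := by omega
    have ht1 : t 1 = 0 := by omega
    simp [fv, ht0, ht1, h0]
  have hDr : (0 : ℝ) < D := by exact_mod_cast hD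
  have hx : (0 : ℝ) ≤ t 0 := by positivity
  have hy : (0 : ℝ) ≤ t 1 := by positivity
  have hsum : ((t 0 : ℕ) : ℝ) + t 1 ≤ D := by exact_mod_cast ht
  -- D * fv t = t0 (ξ₀ D) + t1 (ξ₁ D) ≥ t0 m + t1 m + (D - t0 - t1) m = D m
  have key : (D : ℝ) * fv ξ₀ ξ₁ t = (t 0 : ℝ) * (ξ₀ * D) + (t 1 : ℝ) * (ξ₁ * D) := by
    simp only [fv]; ring
  have e1 : (t 0 : ℝ) * m ≤ (t 0 : ℝ) * (ξ₀ * D) := mul_le_mul_of_nonneg_left h1 hx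
  have e2 : (t 1 : ℝ) * m ≤ (t 1 : ℝ) * (ξ₁ * D) := mul_le_mul_of_nonneg_left h2 hy
  have e3 : ((D : ℝ) - t 0 - t 1) * m ≤ 0 := mul_nonpos_of_nonneg_of_nonpos (by linarith) h0
  have : (D : ℝ) * m ≤ (D : ℝ) * fv ξ₀ ξ₁ t := by rw [key]; nlinarith
  exact le_of_mul_le_mul_left this hDr

end

end Summit.ValiantsHypothesis.ValiantsHypothesis.Theorems.NewtonTauWeak.Negative.AlignedPeelingCex
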